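/-
Copyright (c) 2026 the pub-hodgecm-mathlib formalisation cell (harness21).  Prover seat hodgecm-mathlib-B-p08 (g41) = tier-1 ASSEMBLER of unit U2G_Census (heir LEAD F0P3a-plan
T17-31 (R-9); dealer LH4-plan (g10) WORD #8∕#10; desk F0P3-plan (g21) INVENTORY v1 56a02b7f4f575bad §U2G); DEFS LEAF of the unit; 2026-09-03.
-/
import Summits.HodgeConjecture.HodgeConjecture.Theorems.F0P3cDyRamFourFramePieces   -- ★ DEFS LEAF №3 «PIECES∕SLICES» (dealer g10, v3 4228641d234f08cc): `wMatrix`, `InLevel`, `valueSetMod`, `xPlus`,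
                                                                                  -- `LabelPlus`, `NearTransvShell`, `edgeFixCount`, `dOfPlace`, `mstarFn`, `pieceUnit0∕Edge∕TransvPlus∕TransvMinus∕Reg`, `gselStar`
import HarnessLib

/-!
# Crux `H413`, line LH4 «(D-RAM) FOUR-FRAME» road, STAGE 1a — DEFS LEAF of tier-1 unit U2G «G-SIDE CENSUS DICTIONARY»: the lattice-side profile labels, the profile
# FIXED-VERTEX COUNTS, and the per-piece dictionary Prop `PieceCountDictionary g cnt` («`Φ(⟦γ⟧, g) = ν(K) · cnt(ι_w γ)`» on the type-(1) population)

Cell `hodgecm-mathlib` (D-0151), FLOOR 0, crux item H413 = `stmt-HodgeConjecture-24833`, route of record `HCCMUnconditional`; squad F0∕P3c∕LH4 (req618, director s1808);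
heir LEAD F0P3a-plan T17-31 (R-9)∕(R-10) (tier-1 socket module per unit; «every statement over DEFS names; no free constants; explicit pieces; laws only where census-backed»);
dealer LH4-plan (g10) WORD #8 (6) ∕ WORD #10 (tier-0 selector `gselStar = (1_K, f_{T+}, f_{T−}, f_reg)`, `g_E` kept as a def for the edge law); desk F0P3-plan (g21) INVENTORY v1
56a02b7f4f575bad §U2G (rows `dict_unit0∕edge∕transvection∕regular`, `measure_normalisation`).  DEFINITIONS ONLY (+ `rfl`-grade unfoldings); no instance, no notation, no
`sorry`, no theorem asserting anything about `U(3)`; lane `--supports stmt-HodgeConjecture-24833 --as helper` (count-neutral).  Precedents: ★ №2b `F0P3cDyRamFourFrameDictionaryDefs`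
((D-G) `AnchorCountDictionary t`), ★ №3 `F0P3cDyRamFourFramePieces`.

WHY A DEFS LEAF.  The unit's stubs (module `Cruxes/H413/Lines/F0_P3c_DyRamFourFrame/U2G_Census.lean`) and its tier-2 prover files must conclude Props that live in a sorry-free
tree module BY NAME (T11-93 ∕ T17-28 (D2′)).  The (D-G) Prop of GATE 1a-1 covers the piece `1_{K_t}` only; the tier-0 selector of record (WORD #10) has THREE more explicit pieces
`f_{T+}, f_{T−}, f_reg` (★ №3 `pieceTransvPlus ∕ pieceTransvMinus ∕ pieceReg`, indicators of LEVEL-`m*` PROFILE sets inside `K = Stab(𝒪_w³)`), plus the edge piece `g_E` (★ №3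
`pieceEdge`) of the (K-1)(c) edge law.  Their census dictionaries need (i) the profile conditions TRANSPORTED TO THE VERTEX (`u := g⁻¹ ι(γ) g ↦ M := g·𝒪³`, `g` unitary) — §1 — and
(ii) the corresponding FIXED-VERTEX COUNTS — §2; §3 packages «orbital integral of the piece at a type-(1) literal = `νG₃(K)` × count at `ι_w γ`» as ONE Prop-valued functional
`PieceCountDictionary g cnt` of a piece selector `g` and a count selector `cnt` (same binder block as (D-G), the anchor binders `N ∕ K_t` specialised to `K = cmLocalIntegralLevel`
because the №3 pieces are pinned to it, and the constant made EXPLICIT: `C = νG₃(K).toReal` — one normalisation for the whole U4 piece table).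

THE MATHEMATICS ([Kottwitz1986, §3]; [Rogawski1990, §4.9 pp. 54–55]; memo (0b-iii) v1.2 §4 profiles; dealer DESIGN v1 (B3); REF5 R5-2∕R5-3 value-set label).  `K` a field with
`Valued K ℤᵐ⁰`, `σ : K →+* K`, `ϖ` a uniformiser, `Φ₃ = (StdForm.antidiagonal 3).over K`, `T ∈ GL₃(K)` acting on lattices by ★ `mapGL`, `X := T − 1`.  For a lattice `M`:
* §1 `LatticeInLevel ϖ ℓ X M :⟺ X·M ⊆ ϖ^ℓ·M` (★ `scaleLattice`) — at `M = g·𝒪³` this is ★ №3 `InLevel ϖ ℓ (g⁻¹Xg)` (★ `map_toLin'_mapGL_stdLattice_le_scaleLattice_iff`);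
  `LatticeNearTransvShell ϖ ℓ m X M :⟺ LatticeInLevel ϖ ℓ X M ∧ ¬ LatticeInLevel ϖ (ℓ+1) X M ∧ LatticeInLevel ϖ m (X·X) M` (★ №3 `NearTransvShell` at the vertex);
  `latticeValueSetMod σ ϖ m M X := {z | ∃ y ∈ M, |ϖ^{−m}(z − ⟨y, Xy⟩_{Φ₃})| ≤ 1}` (★ №3 `valueSetMod` = the case `M = 𝒪³`; for `g` UNITARY, `⟨gy, X gy⟩ = ⟨y, (g⁻¹Xg) y⟩`, so the
  set at `M = g·𝒪³` is `valueSetMod σ ϖ m (g⁻¹Xg)`); `LatticeLabelPlus σ ϖ d m M X :⟺ latticeValueSetMod σ ϖ m M X = valueSetMod σ ϖ m (xPlus σ ϖ d)` (★ №3 `LabelPlus` at the vertex).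
* §2 THE PROFILE COUNTS over the TYPE-0 vertices `M` (★ `IsVertexLattice σ ϖ Φ₃ 0 M`) FIXED by `T` (`mapGL T M = M`): `transvPlusFixCount σ ϖ d ℓ m T` (shell `(ℓ, m)` + label +),
  `transvMinusFixCount` (shell, label −), `regFixCount σ ϖ m T` (`¬ (T−1)²·M ⊆ ϖ^m·M`); `fixedEdgeCount σ ϖ T` (fixed flags `N < M`, type 2 below type 0 = fixed EDGES — the edge piece's census function; ★ №3 `edgeFixCount` is its root-local summand);
  the anchor count is ★ #0a `fixedVertexCount σ ϖ 0 T`.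
  COUNT SELECTORS (the type the dictionary Prop quantifies over; `(L, v, w, hw, ϖ) ↦ GL₃(L_w) → ℕ`): `cntUnit0` (= `fixedVertexCount σ_w ϖ 0`), `cntEdge` (= `fixedEdgeCount σ_w ϖ`),
  `cntTransvPlus ∕ cntTransvMinus` (`d := dOfPlace L v w`, `ℓ := d % 2`, `m := mstarFn L v w` — the SAME level schedule the ★ №3 pieces read), `cntReg`; `cntStar := (cntUnit0,
  cntTransvPlus, cntTransvMinus, cntReg)` indexed like ★ `gselStar`.
* §3 `PieceCountDictionary (g) (cnt) : Prop` — at every wild ramified non-split place (binders of (D-G) VERBATIM: `w` σ-stable, `e(w|v) ≠ 1`, `2 ∉ 𝒪_w^×`, uniformiser `ϖ`,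
  measurability data, `νG₃` Haar, `mG₃` canonical), for every four-frame family `f`, `α, β, z ∈ E¹` with `α ≠ β`, `α, β ≠ 1`, frame `b`, `Γ = frameElt σ_w f b α β` and every `γ`
  whose place matrix is `z·Γ`:  `classOrbitalIntegral mG₃ (g L v w hw ϖ) ⟦γ⟧ = (νG₃ K).toReal · cnt L v w hw ϖ (ι_w γ)`, `K = cmLocalIntegralLevel L 3 Φ₃ v`, `ι_w = localNonsplitEquiv`.
  The U2G stubs are `PieceCountDictionary (gselStar j) (cntStar j)` (`j = 1, 2, 3`; `j = 0` is ★ p854635 up to `K_0 = K`) and `PieceCountDictionary pieceEdge cntEdge`.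
HONEST LABEL: HC_CM is proved only modulo the 7 printed citations (2 remaining named inputs: hLiu418 = stmt-HodgeConjecture-24832, h413 = stmt-HodgeConjecture-24833) until rung 0
closes; count-neutral (definitions only; the census dictionaries are PROVER TARGETS of unit U2G, never facts; the road is registry-moving only on completion).

## References
* [Kottwitz1986] R. E. Kottwitz, *Base change for unit elements of Hecke algebras*, Compositio Math. 60 (1986), §3 (fixed points on the building; congruence-level strata).
* [Rogawski1990] J. D. Rogawski, *Automorphic Representations of Unitary Groups in Three Variables*, Ann. of Math. Stud. 123 (1990), §4.9 Prop. 4.9.1 (b) p. 55 (orbital integrals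
  of compact-open indicators as lattice counts).
* [Laumon1995] G. Laumon, *Cohomology of Drinfeld Modular Varieties I* (1996), Lemma (5.3.2) p. 136 (the fixed-coset formula with the Haar constant).
-/

noncomputable section

namespace Summit.HodgeConjecture.HodgeConjecture.Cruxes.H413.F0P3cDyRamFourFrameCensusDefs

open MeasureTheory Measure NumberField IsDedekindDomain Topology Filter
open Literature.NumberTheory.Automorphic Literature.NumberTheory.Automorphic.UnitaryGroup Literature.NumberTheory.Automorphic.IntegralReduction
open Literature.NumberTheory.Automorphic.UnitaryLatticeTree Literature.NumberTheory.Automorphic.HermitianLattice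
open Literature.NumberTheory.Rogawski1990 Literature.NumberTheory.GaloisRepresentations
open Literature.MeasureTheory.Group (descConj)
open Literature.NumberTheory.Automorphic.UnitaryThreeFourFrame
open Summit.HodgeConjecture.HodgeConjecture.Cruxes.H413.F0P3cDyRamFourFramePieces
open scoped Matrix MatrixGroups Classical ValuativeRel WithZero

/-! ## §1  Profile labels transported to a vertex `M` (any lattice; `X = T − 1`) -/

section Labels

variable {K : Type*} [Field K] [Valued K ℤᵐ⁰]

/-- `LatticeInLevel ϖ ℓ X M` — `X·M ⊆ ϖ^ℓ·M`: the lattice-side reading of ★ №3 `InLevel ϖ ℓ (g⁻¹Xg)` at the vertex `M = g·𝒪³` (★ `map_toLin'_mapGL_stdLattice_le_scaleLattice_iff`).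
[cite: Kottwitz1986, §3] -/
def LatticeInLevel (ϖ : K) (ℓ : ℕ) (X : Matrix (Fin 3) (Fin 3) K) (M : Submodule (Valued.integer K) (Fin 3 → K)) : Prop :=
  M.map ((Matrix.toLin' X).restrictScalars (Valued.integer K)) ≤ scaleLattice (ϖ ^ ℓ) M

/-- `LatticeNearTransvShell ϖ ℓ m X M` — the NEAR-TRANSVECTION SHELL read at the vertex: `X·M ⊆ ϖ^ℓ M`, `X·M ⊄ ϖ^{ℓ+1} M`, `X²·M ⊆ ϖ^m M` (★ №3 `NearTransvShell ϖ ℓ m (g⁻¹Xg)`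
at `M = g·𝒪³`). [cite: Kottwitz1986, §3] -/
def LatticeNearTransvShell (ϖ : K) (ℓ m : ℕ) (X : Matrix (Fin 3) (Fin 3) K) (M : Submodule (Valued.integer K) (Fin 3 → K)) : Prop :=
  LatticeInLevel ϖ ℓ X M ∧ ¬ LatticeInLevel ϖ (ℓ + 1) X M ∧ LatticeInLevel ϖ m (X * X) M

/-- `latticeValueSetMod σ ϖ m M X` — the set of hermitian values `⟨y, Xy⟩_{Φ₃}`, `y ∈ M`, thickened by `ϖ^m` (★ №3 `valueSetMod σ ϖ m X` is the case `M = 𝒪³`; for unitary `g`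
with `g·𝒪³ = M` it equals `valueSetMod σ ϖ m (g⁻¹Xg)`). [cite: Rogawski1990, §4.9 Prop. 4.9.1 (b) p. 55] -/
def latticeValueSetMod (σ : K →+* K) (ϖ : K) (m : ℕ) (M : Submodule (Valued.integer K) (Fin 3 → K)) (X : Matrix (Fin 3) (Fin 3) K) : Set K :=
  {z | ∃ y ∈ M, Valued.v ((ϖ ^ m)⁻¹ * (z - pairing σ ((StdForm.antidiagonal 3).over K) y (X.mulVec y))) ≤ 1}

/-- `LatticeLabelPlus σ ϖ d m M X` — the TRANSVECTION LABEL `+` read at the vertex `M`: the thickened value set of `X` on `M` equals that of the reference class-`+` nilpotent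
★ №3 `xPlus σ ϖ d` on `𝒪³` (★ №3 `LabelPlus σ ϖ d m (g⁻¹Xg)` at `M = g·𝒪³`, `g` unitary). [cite: Rogawski1990, §4.9 Prop. 4.9.1 (b) p. 55] -/
def LatticeLabelPlus (σ : K →+* K) (ϖ : K) (d m : ℕ) (M : Submodule (Valued.integer K) (Fin 3 → K)) (X : Matrix (Fin 3) (Fin 3) K) : Prop :=
  latticeValueSetMod σ ϖ m M X = valueSetMod σ ϖ m (xPlus σ ϖ d)

/-! ## §2  The profile fixed-vertex counts (type-0 vertices of the lattice graph of `(K³, Φ₃)`) and the count selectors -/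

/-- `transvPlusFixCount σ ϖ d ℓ m T` — the number of TYPE-0 vertices `M` FIXED by `T` at which `T − 1` lies in the near-transvection shell `(ℓ, m)` with label `+`
(the fixed-vertex count the piece `f_{T+}` sees; finite for elliptic `T`, `Set.ncard`). [cite: Kottwitz1986, §3] [cite: Rogawski1990, §4.9 Prop. 4.9.1 (b) p. 55] -/
def transvPlusFixCount (σ : K →+* K) (ϖ : K) (d ℓ m : ℕ) (T : GL (Fin 3) K) : ℕ :=
  {M : Submodule (Valued.integer K) (Fin 3 → K) | IsVertexLattice σ ϖ ((StdForm.antidiagonal 3).over K) 0 M ∧ mapGL T M = M ∧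
      LatticeNearTransvShell ϖ ℓ m ((T : Matrix (Fin 3) (Fin 3) K) - 1) M ∧ LatticeLabelPlus σ ϖ d m M ((T : Matrix (Fin 3) (Fin 3) K) - 1)}.ncard

/-- `transvMinusFixCount σ ϖ d ℓ m T` — the same count with label `−` (`¬ LatticeLabelPlus`: on the shell the complement of the `+` class is the other class, REF5 R5-3 (C)).
[cite: Kottwitz1986, §3] [cite: Rogawski1990, §4.9 Prop. 4.9.1 (b) p. 55] -/
def transvMinusFixCount (σ : K →+* K) (ϖ : K) (d ℓ m : ℕ) (T : GL (Fin 3) K) : ℕ :=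
  {M : Submodule (Valued.integer K) (Fin 3 → K) | IsVertexLattice σ ϖ ((StdForm.antidiagonal 3).over K) 0 M ∧ mapGL T M = M ∧
      LatticeNearTransvShell ϖ ℓ m ((T : Matrix (Fin 3) (Fin 3) K) - 1) M ∧ ¬ LatticeLabelPlus σ ϖ d m M ((T : Matrix (Fin 3) (Fin 3) K) - 1)}.ncard

/-- `regFixCount σ ϖ m T` — the number of TYPE-0 vertices `M` FIXED by `T` with the REGULAR profile `(T − 1)²·M ⊄ ϖ^m·M` (the count the piece `f_reg` sees).
[cite: Kottwitz1986, §3] [cite: Rogawski1990, §4.9 Prop. 4.9.1 (b) p. 55] -/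
def regFixCount (σ : K →+* K) (ϖ : K) (m : ℕ) (T : GL (Fin 3) K) : ℕ :=
  {M : Submodule (Valued.integer K) (Fin 3 → K) | IsVertexLattice σ ϖ ((StdForm.antidiagonal 3).over K) 0 M ∧ mapGL T M = M ∧
      ¬ LatticeInLevel ϖ m (((T : Matrix (Fin 3) (Fin 3) K) - 1) * ((T : Matrix (Fin 3) (Fin 3) K) - 1)) M}.ncard

/-- `fixedEdgeCount σ ϖ T` — the number of EDGES of the lattice graph of `(K³, Φ₃)` FIXED by `T`: flags `N < M` with `M` of type 0, `N` of type 2 (★ adjacency = strict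
containment; a type-2 lattice below a type-0 one is a neighbour), both fixed.  This — not ★ №3 `edgeFixCount σ ϖ T` (the fixed type-2 neighbours of the ROOT only) — is the
count the edge piece `g_E = Σ_{N ∼ 𝒪³} 1_{K ∩ Stab N}` sees in its orbital integral: `Σ_{fixed type-0 M = x·𝒪³} edgeFixCount(x⁻¹γx) = #{fixed flags}` = `e(γ)` of the desk's
row `dict_edge` ((K-1)(c): `e = n₀ + n₂ − 1` on a fixed subtree). [cite: Kottwitz1986, §3] -/
def fixedEdgeCount (σ : K →+* K) (ϖ : K) (T : GL (Fin 3) K) : ℕ :=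
  {p : Submodule (Valued.integer K) (Fin 3 → K) × Submodule (Valued.integer K) (Fin 3 → K) |
      IsVertexLattice σ ϖ ((StdForm.antidiagonal 3).over K) 0 p.1 ∧ IsVertexLattice σ ϖ ((StdForm.antidiagonal 3).over K) 2 p.2 ∧ p.2 ≤ p.1 ∧
      mapGL T p.1 = p.1 ∧ mapGL T p.2 = p.2}.ncard

end Labels

/-- COUNT SELECTOR `cntUnit0` — the anchor count `(L, v, w, hw, ϖ, T) ↦ fixedVertexCount σ_w ϖ 0 T` (★ #0a H2; the (D-G) `t = 0` count). [cite: Rogawski1990, §4.9 Prop. 4.9.1 (b) p. 55] -/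
def cntUnit0 : (∀ (L : Type) [Field L] [NumberField L] [IsCMField L] (v : HeightOneSpectrum (𝓞 ↥(maximalRealSubfield L))) (w : UnitaryGroup.PlacesOver L v), IsCMField.complexConj L • w.1 = w.1 → w.1.adicCompletion L → GL (Fin 3) (w.1.adicCompletion L) → ℕ) :=
  fun L _ _ _ _v _w hw ϖ T => fixedVertexCount (galAdicCompletionMap (L := L) (IsCMField.complexConj L) hw) ϖ 0 T

/-- COUNT SELECTOR `cntEdge` — the fixed-EDGE count `fixedEdgeCount σ_w ϖ T` (§2; the (K-1)(c) edge piece `g_E`'s census function `e(γ)`). [cite: Kottwitz1986, §3] -/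
def cntEdge : (∀ (L : Type) [Field L] [NumberField L] [IsCMField L] (v : HeightOneSpectrum (𝓞 ↥(maximalRealSubfield L))) (w : UnitaryGroup.PlacesOver L v), IsCMField.complexConj L • w.1 = w.1 → w.1.adicCompletion L → GL (Fin 3) (w.1.adicCompletion L) → ℕ) :=
  fun L _ _ _ _v _w hw ϖ T => fixedEdgeCount (galAdicCompletionMap (L := L) (IsCMField.complexConj L) hw) ϖ T

/-- COUNT SELECTOR `cntTransvPlus` — `transvPlusFixCount σ_w ϖ d (d % 2) m* T` with `d = dOfPlace L v w`, `m* = mstarFn L v w` (the level schedule of the ★ №3 pieces).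
[cite: Kottwitz1986, §3] -/
def cntTransvPlus : (∀ (L : Type) [Field L] [NumberField L] [IsCMField L] (v : HeightOneSpectrum (𝓞 ↥(maximalRealSubfield L))) (w : UnitaryGroup.PlacesOver L v), IsCMField.complexConj L • w.1 = w.1 → w.1.adicCompletion L → GL (Fin 3) (w.1.adicCompletion L) → ℕ) :=
  fun L _ _ _ v w hw ϖ T => transvPlusFixCount (galAdicCompletionMap (L := L) (IsCMField.complexConj L) hw) ϖ (dOfPlace L v w) (dOfPlace L v w % 2) (mstarFn L v w) T

/-- COUNT SELECTOR `cntTransvMinus` — `transvMinusFixCount σ_w ϖ d (d % 2) m* T`, `d = dOfPlace L v w`, `m* = mstarFn L v w`. [cite: Kottwitz1986, §3] -/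
def cntTransvMinus : (∀ (L : Type) [Field L] [NumberField L] [IsCMField L] (v : HeightOneSpectrum (𝓞 ↥(maximalRealSubfield L))) (w : UnitaryGroup.PlacesOver L v), IsCMField.complexConj L • w.1 = w.1 → w.1.adicCompletion L → GL (Fin 3) (w.1.adicCompletion L) → ℕ) :=
  fun L _ _ _ v w hw ϖ T => transvMinusFixCount (galAdicCompletionMap (L := L) (IsCMField.complexConj L) hw) ϖ (dOfPlace L v w) (dOfPlace L v w % 2) (mstarFn L v w) T

/-- COUNT SELECTOR `cntReg` — `regFixCount σ_w ϖ m* T`, `m* = mstarFn L v w`. [cite: Kottwitz1986, §3] -/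
def cntReg : (∀ (L : Type) [Field L] [NumberField L] [IsCMField L] (v : HeightOneSpectrum (𝓞 ↥(maximalRealSubfield L))) (w : UnitaryGroup.PlacesOver L v), IsCMField.complexConj L • w.1 = w.1 → w.1.adicCompletion L → GL (Fin 3) (w.1.adicCompletion L) → ℕ) :=
  fun L _ _ _ v w hw ϖ T => regFixCount (galAdicCompletionMap (L := L) (IsCMField.complexConj L) hw) ϖ (mstarFn L v w) T

/-- `cntStar = (cntUnit0, cntTransvPlus, cntTransvMinus, cntReg)` — the count selectors indexed like ★ №3 `gselStar = (1_K, f_{T+}, f_{T−}, f_reg)`. [cite: Kottwitz1986, §3] -/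
def cntStar : Fin 4 → (∀ (L : Type) [Field L] [NumberField L] [IsCMField L] (v : HeightOneSpectrum (𝓞 ↥(maximalRealSubfield L))) (w : UnitaryGroup.PlacesOver L v), IsCMField.complexConj L • w.1 = w.1 → w.1.adicCompletion L → GL (Fin 3) (w.1.adicCompletion L) → ℕ) :=
  ![cntUnit0, cntTransvPlus, cntTransvMinus, cntReg]

/-! ## §3  The per-piece census dictionary Prop on the type-(1) population -/

/-- **`PieceCountDictionary g cnt` — THE CENSUS DICTIONARY OF AN EXPLICIT PIECE ON THE TYPE-(1) POPULATION** (unit U2G; NEW; the (D-G) binder block VERBATIM with the anchor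
`K_t` specialised to `K = cmLocalIntegralLevel` and the constant made explicit).  At every wild ramified non-split place `w ∣ v` (σ-stable, `e(w|v) ≠ 1`, `2 ∉ 𝒪_w^×`), every
uniformiser `ϖ`, for the canonical orbital family `mG₃` w.r.t. the Haar measure `νG₃`: for every four-frame family `f`, `α, β, z ∈ E¹` with `α ≠ β`, `α, β ≠ 1`, frame `b`,
`Γ = frameElt σ_w f b α β` and every `γ ∈ U(Φ₃)(L⁺_v)` whose place matrix is `z·Γ`:
`Φ(⟦γ⟧, g; mG₃) = νG₃(K).toReal · cnt(ι_w γ)`.  For `g = 1_K`, `cnt = n_0` this is (D-G) at `t = 0` with `C_0 = νG₃(K)` (★ p854635); for the profile pieces it is the profile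
census dictionary (tier-2 proof: ★ `classOrbitalIntegral`-as-fixed-coset-sum with an `Ad K`-invariant weight + the §1 transport + htr₀-wild ★ p854568). A PROVER TARGET, not a fact.
[cite: Rogawski1990, §4.9 Prop. 4.9.1 (b) p. 55] [cite: Kottwitz1986, §3] [cite: Laumon1995, Lemma (5.3.2) p. 136] -/
def PieceCountDictionary (g : (∀ (L : Type) [Field L] [NumberField L] [IsCMField L] (v : HeightOneSpectrum (𝓞 ↥(maximalRealSubfield L))) (w : UnitaryGroup.PlacesOver L v), IsCMField.complexConj L • w.1 = w.1 → w.1.adicCompletion L → ((UnitaryGroup.cmDatum L 3 (Matrix.of fun i j : Fin 3 => if i.val + j.val + 1 = 3 then (1 : L) else 0)).Local v) → ℂ))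
    (cnt : (∀ (L : Type) [Field L] [NumberField L] [IsCMField L] (v : HeightOneSpectrum (𝓞 ↥(maximalRealSubfield L))) (w : UnitaryGroup.PlacesOver L v), IsCMField.complexConj L • w.1 = w.1 → w.1.adicCompletion L → GL (Fin 3) (w.1.adicCompletion L) → ℕ)) : Prop :=
    ∀ (L : Type) [Field L] [NumberField L] [IsCMField L]
      {v : HeightOneSpectrum (𝓞 ↥(maximalRealSubfield L))} (w : UnitaryGroup.PlacesOver L v)
      (hw : IsCMField.complexConj L • w.1 = w.1) (_he : v.asIdeal.ramificationIdx' w.1.asIdeal ≠ 1)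
      (_h2 : ¬ IsUnit (2 : 𝒪[w.1.adicCompletion L]))
      (ϖ : (w.1.adicCompletion L)) (_hϖ : Valued.v ϖ = WithZero.exp (-1 : ℤ))
      [MeasurableSpace ((UnitaryGroup.cmDatum L 3 (Matrix.of fun i j : Fin 3 => if i.val + j.val + 1 = 3 then (1 : L) else 0)).Local v)] [BorelSpace ((UnitaryGroup.cmDatum L 3 (Matrix.of fun i j : Fin 3 => if i.val + j.val + 1 = 3 then (1 : L) else 0)).Local v)]
      [∀ γ : ((UnitaryGroup.cmDatum L 3 (Matrix.of fun i j : Fin 3 => if i.val + j.val + 1 = 3 then (1 : L) else 0)).Local v), MeasurableSpace (((UnitaryGroup.cmDatum L 3 (Matrix.of fun i j : Fin 3 => if i.val + j.val + 1 = 3 then (1 : L) else 0)).Local v) ⧸ Subgroup.centralizer ({γ} : Set ((UnitaryGroup.cmDatum L 3 (Matrix.of fun i j : Fin 3 => if i.val + j.val + 1 = 3 then (1 : L) else 0)).Local v)))]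
      [∀ γ : ((UnitaryGroup.cmDatum L 3 (Matrix.of fun i j : Fin 3 => if i.val + j.val + 1 = 3 then (1 : L) else 0)).Local v), BorelSpace (((UnitaryGroup.cmDatum L 3 (Matrix.of fun i j : Fin 3 => if i.val + j.val + 1 = 3 then (1 : L) else 0)).Local v) ⧸ Subgroup.centralizer ({γ} : Set ((UnitaryGroup.cmDatum L 3 (Matrix.of fun i j : Fin 3 => if i.val + j.val + 1 = 3 then (1 : L) else 0)).Local v)))]
      (νG₃ : Measure ((UnitaryGroup.cmDatum L 3 (Matrix.of fun i j : Fin 3 => if i.val + j.val + 1 = 3 then (1 : L) else 0)).Local v)) [νG₃.IsHaarMeasure] [νG₃.IsMulRightInvariant]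
      (mG₃ : OrbitalMeasureFamily ((UnitaryGroup.cmDatum L 3 (Matrix.of fun i j : Fin 3 => if i.val + j.val + 1 = 3 then (1 : L) else 0)).Local v)), mG₃.IsCanonical (fun γ => IsRegularElt (γ.val : GL (Fin 3) (UnitaryGroup.LocalRing L v))) νG₃ →
      ∀ (f : Fin 4 → Fin 3 → (Fin 3 → (w.1.adicCompletion L))), IsFourFrameFamily (galAdicCompletionMap (L := L) (IsCMField.complexConj L) hw) f →
        ∀ (α β z : (w.1.adicCompletion L)), α * (galAdicCompletionMap (L := L) (IsCMField.complexConj L) hw) α = 1 → β * (galAdicCompletionMap (L := L) (IsCMField.complexConj L) hw) β = 1 → z * (galAdicCompletionMap (L := L) (IsCMField.complexConj L) hw) z = 1 → α ≠ β → α ≠ 1 → β ≠ 1 →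
        ∀ (b : Fin 4) (Γ : GL (Fin 3) (w.1.adicCompletion L)), (Γ : Matrix (Fin 3) (Fin 3) (w.1.adicCompletion L)) = frameElt (galAdicCompletionMap (L := L) (IsCMField.complexConj L) hw) f b α β →
        ∀ (γ : ((UnitaryGroup.cmDatum L 3 (Matrix.of fun i j : Fin 3 => if i.val + j.val + 1 = 3 then (1 : L) else 0)).Local v)), ((((localNonsplitEquiv (IsCMField.complexConj L) (Matrix.of fun i j : Fin 3 => if i.val + j.val + 1 = 3 then (1 : L) else 0) (IsCMField.complexConj_ne_one L) w hw γ :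
              ↥(unitaryGroupOfForm (galAdicCompletionMap (L := L) (IsCMField.complexConj L) hw) (placeForm (Matrix.of fun i j : Fin 3 => if i.val + j.val + 1 = 3 then (1 : L) else 0) w.1))) : GL (Fin 3) (w.1.adicCompletion L)) : Matrix (Fin 3) (Fin 3) (w.1.adicCompletion L))) = z • (Γ : Matrix (Fin 3) (Fin 3) (w.1.adicCompletion L)) →
          classOrbitalIntegral mG₃ (g L v w hw ϖ) (ConjClasses.mk γ) =
            ((νG₃ (cmLocalIntegralLevel L 3 (Matrix.of fun i j : Fin 3 => if i.val + j.val + 1 = 3 then (1 : L) else 0) v : Set ((UnitaryGroup.cmDatum L 3 (Matrix.of fun i j : Fin 3 => if i.val + j.val + 1 = 3 then (1 : L) else 0)).Local v))).toReal : ℂ) * (cnt L v w hw ϖ ((localNonsplitEquiv (IsCMField.complexConj L) (Matrix.of fun i j : Fin 3 => if i.val + j.val + 1 = 3 then (1 : L) else 0) (IsCMField.complexConj_ne_one L) w hw γ :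
              ↥(unitaryGroupOfForm (galAdicCompletionMap (L := L) (IsCMField.complexConj L) hw) (placeForm (Matrix.of fun i j : Fin 3 => if i.val + j.val + 1 = 3 then (1 : L) else 0) w.1))) : GL (Fin 3) (w.1.adicCompletion L)) : ℂ)

end Summit.HodgeConjecture.HodgeConjecture.Cruxes.H413.F0P3cDyRamFourFrameCensusDefs

end
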